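import Summits.NavierStokesRegularity.NavierStokesRegularity.Theorems.AdaptedFrequencyConverges.Negative.KernelVariances
import Literature.Analysis.FluidPDE.AdaptedBackwardKernel

/-!
# Linear-flow witness, III: the exact adapted kernel

Negative-side support for crux `AdaptedFrequencyConverges` (stmt-NavierStokesRegularity-10493, route
`AdaptedFrequency`), cdisprove seat, cycle 1 (2026-08-16). Part of the kernel-checked proof that the crux is FALSE once
its far-field hypotheses (Leray–Hopf class, rapid decay, sup-norm Type-I) are dropped — `AdaptedFrequencyConvergesWithoutDecay`
in `…Negative.FalseWithoutDecay` — by an EXACT linear Navier–Stokes flow with an EXACT anisotropic Gaussian adapted kernel whose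
adapted frequency `Λ(t) = 2 cos log(1−t)` does not converge.

This file: unit mass and two-sided isotropic bounds of the anisotropic Gaussian, and `G(t) = N(0, diag(α(t), β(t), β(t)))`
as a flow-adapted backward kernel of the linear flow on `[0,1)` with pole `(1, 0)`: the adjoint equation
`∂ₜG + u·∇G + νΔG = 0` (`adjoint_eq_G`), unit mass, joint smoothness, two-sided Gaussian comparability (`G_comparable`),
and concentration — the latter through the general lemma `tendsto_integral_mul_of_le_heatKernel`: a heat-kernel upper
bound + unit mass + positivity imply clause (5), which is therefore REDUNDANT in the adapted-kernel interface (information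
for `AdaptedKernelExists` as well).
-/

noncomputable section

namespace Summit.NavierStokesRegularity.NavierStokesRegularity.Theorems.AdaptedFrequencyConverges.Negative

open scoped Matrix InnerProductSpace RealInnerProductSpace Laplacian Topology
open Literature.Analysis.FluidPDE Set Filter MeasureTheory Real intervalIntegral

/-! ## Part C2: mass and bounds -/


/-- 1D Gaussian mass `∫ exp(−y²/(2v)) dy = √(2πv)` [folklore] -/
theorem integral_exp_neg_sq_div (v : ℝ) :
    ∫ y : ℝ, Real.exp (-(y ^ 2) / (2 * v)) = Real.sqrt (2 * π * v) := by
  have h := integral_gaussian (2 * v)⁻¹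
  have e : (fun y : ℝ => Real.exp (-(2 * v)⁻¹ * y ^ 2)) = fun y => Real.exp (-(y ^ 2) / (2 * v)) := by
    funext y; congr 1; rw [div_eq_mul_inv]; ring
  rw [e] at h
  rw [h]
  congr 1
  rw [div_inv_eq_mul]; ring

/-- **unit mass** of the anisotropic Gaussian [folklore] -/
theorem integral_gK {a b : ℝ} (ha : 0 < a) (hb : 0 < b) : ∫ x : E3, gK a b x = 1 := by
  have hmp : MeasurePreserving (MeasurableEquiv.toLp 2 (Fin 3 → ℝ)) :=
    PiLp.volume_preserving_toLp (Fin 3)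
  simp only [gK, MeasureTheory.integral_const_mul]
  rw [← hmp.integral_comp']
  -- the integrand is a product over coordinates
  have hprod : ∀ y : Fin 3 → ℝ, Real.exp (-(gQ a b ((MeasurableEquiv.toLp 2 (Fin 3 → ℝ)) y))) =
      ∏ i : Fin 3, Real.exp (-((y i) ^ 2) / (2 * (if i = 0 then a else b))) := by
    intro y
    rw [Fin.prod_univ_three, ← Real.exp_add, ← Real.exp_add]
    congr 1
    simp [gQ]
    ring
  simp_rw [hprod]
  rw [volume_pi, integral_fintype_prod_eq_prod
    (f := fun (i : Fin 3) (s : ℝ) => Real.exp (-(s ^ 2) / (2 * (if i = 0 then a else b))))]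
  rw [Fin.prod_univ_three]
  simp only [Fin.isValue, ↓reduceIte, Fin.one_eq_zero_iff, OfNat.ofNat_ne_one,
    Fin.reduceEq]
  rw [integral_exp_neg_sq_div a, integral_exp_neg_sq_div b, gC]
  have h2 : Real.sqrt (2 * π * b) * Real.sqrt (2 * π * b) = 2 * π * b :=
    Real.mul_self_sqrt (by positivity)
  have hpos : 0 < Real.sqrt (2 * π * a) * (2 * π * b) := by positivity
  rw [mul_assoc (Real.sqrt (2 * π * a)), h2]
  exact inv_mul_cancel₀ hpos.ne'

/-- `‖x‖² = x₀² + x₁² + x₂²` on `ℝ³`. [folklore] -/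
theorem norm_sq_eq (x : E3) : ‖x‖ ^ 2 = (x 0) ^ 2 + (x 1) ^ 2 + (x 2) ^ 2 := by
  rw [EuclideanSpace.norm_eq, Real.sq_sqrt (by positivity)]
  simp [Fin.sum_univ_three]

/-- `‖x‖²/(2M) ≤ Q(x) ≤ ‖x‖²/(2m)` when `m ≤ a, b ≤ M` [folklore] -/
theorem gQ_bounds {a b m M : ℝ} (hm : 0 < m) (hma : m ≤ a) (hmb : m ≤ b) (haM : a ≤ M) (hbM : b ≤ M)
    (x : E3) : ‖x‖ ^ 2 / (2 * M) ≤ gQ a b x ∧ gQ a b x ≤ ‖x‖ ^ 2 / (2 * m) := by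
  have ha : 0 < a := hm.trans_le hma
  have hb : 0 < b := hm.trans_le hmb
  have hM : 0 < M := ha.trans_le haM
  rw [norm_sq_eq, gQ]
  have h0 := sq_nonneg (x 0); have h1 := sq_nonneg (x 1); have h2 := sq_nonneg (x 2)
  constructor
  · rw [show ((x 0) ^ 2 + (x 1) ^ 2 + (x 2) ^ 2) / (2 * M) = (x 0) ^ 2 / (2 * M) + ((x 1) ^ 2 + (x 2) ^ 2) / (2 * M) by ring]
    gcongr
  · rw [show ((x 0) ^ 2 + (x 1) ^ 2 + (x 2) ^ 2) / (2 * m) = (x 0) ^ 2 / (2 * m) + ((x 1) ^ 2 + (x 2) ^ 2) / (2 * m) by ring]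
    gcongr

/-- the normalising constant is antitone in both variances [folklore] -/
theorem gC_le_gC {a b a' b' : ℝ} (ha' : 0 < a') (hb' : 0 < b') (ha : a' ≤ a) (hb : b' ≤ b) :
    gC a b ≤ gC a' b' := by
  unfold gC
  have : 0 < Real.sqrt (2 * π * a') * (2 * π * b') := by positivity
  apply inv_anti₀ this
  gcongr

/-- two-sided Gaussian bounds of the anisotropic kernel [folklore] -/
theorem gK_le {a b m M : ℝ} (hm : 0 < m) (hma : m ≤ a) (hmb : m ≤ b) (haM : a ≤ M) (hbM : b ≤ M)
    (x : E3) : gK a b x ≤ gC m m * Real.exp (-(‖x‖ ^ 2) / (2 * M)) := by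
  have ha : 0 < a := hm.trans_le hma
  have hb : 0 < b := hm.trans_le hmb
  unfold gK
  refine mul_le_mul (gC_le_gC hm hm hma hmb) ?_ (Real.exp_pos _).le ?_
  · rw [Real.exp_le_exp, neg_div]; exact neg_le_neg (gQ_bounds hm hma hmb haM hbM x).1
  · unfold gC; positivity

/-- Lower Gaussian bound of `K` when `m ≤ a, b ≤ M`. [folklore] -/
theorem le_gK {a b m M : ℝ} (hm : 0 < m) (hma : m ≤ a) (hmb : m ≤ b) (haM : a ≤ M) (hbM : b ≤ M)
    (x : E3) : gC M M * Real.exp (-(‖x‖ ^ 2) / (2 * m)) ≤ gK a b x := by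
  have ha : 0 < a := hm.trans_le hma
  have hb : 0 < b := hm.trans_le hmb
  unfold gK
  refine mul_le_mul (gC_le_gC ha hb haM hbM) ?_ (Real.exp_pos _).le ?_
  · rw [Real.exp_le_exp, neg_div]; exact neg_le_neg (gQ_bounds hm hma hmb haM hbM x).2
  · unfold gC; positivity

/-- `gC m m = (2πm)^{-3/2}` [folklore] -/
theorem gC_self {m : ℝ} (hm : 0 < m) : gC m m = (2 * π * m) ^ (-(3:ℝ) / 2) := by
  unfold gC
  have h : 0 < 2 * π * m := by positivity
  rw [Real.sqrt_eq_rpow, ← Real.rpow_one (2 * π * m), ← Real.rpow_mul h.le,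
    ← Real.rpow_add h, ← Real.rpow_neg h.le, Real.rpow_one]
  norm_num


/-! ## Part C3: concentration from a Gaussian upper bound (general lemma) -/

/-- **Concentration is implied by a heat-kernel upper bound plus unit mass.** If, for `t ↑ T`,
the slices `G t` are nonnegative, have unit mass and lie below a constant multiple of a backward
heat kernel with pole `(T, x₀)`, then `∫ φ G(t) → φ(x₀)` for every bounded continuous `φ`.
(So clause (5) of the adapted-kernel interface is redundant given comparability and (4).) [folklore] -/
theorem tendsto_integral_mul_of_le_heatKernel {G : ℝ → E3 → ℝ} {T : ℝ} {x₀ : E3} {K ν' : ℝ}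
    (hν' : 0 < ν')
    (hG : ∀ᶠ t in 𝓝[<] T, (∀ x, 0 ≤ G t x) ∧ (∫ x, G t x = 1) ∧
      ∀ x, G t x ≤ K * backwardHeatKernel ν' T x₀ t x)
    {φ : E3 → ℝ} (hφ : Continuous φ) {M : ℝ} (hM : ∀ x, |φ x| ≤ M) :
    Tendsto (fun t => ∫ x, φ x * G t x) (𝓝[<] T) (𝓝 (φ x₀)) := by
  -- test function ψ = |φ - φ x₀|, bounded continuous with ψ x₀ = 0
  set ψ : E3 → ℝ := fun x => |φ x - φ x₀| with hψ
  have hψc : Continuous ψ := (hφ.sub continuous_const).abs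
  have hψM : ∀ x, |ψ x| ≤ 2 * M := fun x => by
    rw [hψ]; simp only [abs_abs]
    calc |φ x - φ x₀| ≤ |φ x| + |φ x₀| := abs_sub _ _
      _ ≤ M + M := add_le_add (hM x) (hM x₀)
      _ = 2 * M := by ring
  have hlim : Tendsto (fun t => ∫ x, ψ x * backwardHeatKernel ν' T x₀ t x) (𝓝[<] T) (𝓝 0) := by
    have := tendsto_integral_mul_backwardHeatKernel hν' T x₀ hψc hψM
    simpa [hψ] using this
  -- squeeze |∫ φ G - φ x₀| ≤ K ∫ ψ Γ
  rw [tendsto_iff_norm_sub_tendsto_zero]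
  refine squeeze_zero' (Eventually.of_forall fun t => norm_nonneg _) ?_
    (by simpa using hlim.const_mul K)
  filter_upwards [hG, self_mem_nhdsWithin] with t ⟨hpos, hmass, hle⟩ htT
  have hint : Integrable (G t) := by
    by_contra h; rw [integral_undef h] at hmass; exact zero_ne_one hmass
  have hK0 : ∀ x, 0 ≤ K * backwardHeatKernel ν' T x₀ t x := fun x => (hpos x).trans (hle x)
  have hΓint : Integrable (backwardHeatKernel ν' T x₀ t) :=
    ((isAdaptedBackwardKernel_backwardHeatKernel hν' T x₀).integrable (t := t) htT)
  have hφG : Integrable (fun x => φ x * G t x) :=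
    hint.bdd_mul hφ.aestronglyMeasurable
      (Eventually.of_forall fun x => by rw [Real.norm_eq_abs]; exact hM x)
  have hψΓ : Integrable (fun x => ψ x * (K * backwardHeatKernel ν' T x₀ t x)) :=
    (hΓint.const_mul K).bdd_mul hψc.aestronglyMeasurable
      (Eventually.of_forall fun x => by rw [Real.norm_eq_abs]; exact hψM x)
  have h1 : (∫ x, φ x * G t x) - φ x₀ = ∫ x, (φ x - φ x₀) * G t x := by
    have e : ∫ x, (φ x - φ x₀) * G t x = (∫ x, φ x * G t x) - ∫ x, φ x₀ * G t x := by
      rw [← integral_sub hφG (hint.const_mul _)]; congr 1; funext x; ring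
    rw [e, MeasureTheory.integral_const_mul, hmass, mul_one]
  rw [h1, Real.norm_eq_abs]
  calc |∫ x, (φ x - φ x₀) * G t x| ≤ ∫ x, |(φ x - φ x₀) * G t x| := abs_integral_le_integral_abs
    _ ≤ ∫ x, ψ x * (K * backwardHeatKernel ν' T x₀ t x) := by
        refine integral_mono_of_nonneg (Eventually.of_forall fun x => abs_nonneg _) hψΓ
          (Eventually.of_forall fun x => ?_)
        simp only [hψ, abs_mul, abs_of_nonneg (hpos x)]
        exact mul_le_mul_of_nonneg_left (hle x) (abs_nonneg _)
    _ = K * ∫ x, ψ x * backwardHeatKernel ν' T x₀ t x := by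
        rw [← MeasureTheory.integral_const_mul]; congr 1; funext x; ring

/-! ## Part C4: the time-dependent adapted kernel of the linear flow -/

/-- time derivative of `s ↦ gK (A s) (B s) x` in closed form [folklore] -/
theorem hasDerivAt_gK_comp {A B : ℝ → ℝ} {A' B' t : ℝ} (hA : HasDerivAt A A' t) (hB : HasDerivAt B B' t)
    (hAt : 0 < A t) (hBt : 0 < B t) (x : E3) :
    HasDerivAt (fun s => gK (A s) (B s) x)
      (gK (A t) (B t) x * (-(A' / (2 * A t)) - B' / B t + (x 0) ^ 2 * A' / (2 * (A t) ^ 2)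
        + ((x 1) ^ 2 + (x 2) ^ 2) * B' / (2 * (B t) ^ 2))) t := by
  have h2A : HasDerivAt (fun s => 2 * π * A s) (2 * π * A') t := hA.const_mul _
  have h2B : HasDerivAt (fun s => 2 * π * B s) (2 * π * B') t := hB.const_mul _
  have hpA : 0 < 2 * π * A t := by positivity
  have hsq := h2A.sqrt hpA.ne'
  have hprod := hsq.mul h2B
  have hne : Real.sqrt (2 * π * A t) * (2 * π * B t) ≠ 0 := by positivity
  have hC : HasDerivAt (fun s => gC (A s) (B s)) _ t := hprod.inv hne
  have hQA := ((hA.const_mul 2).inv (by positivity)).const_mul ((x 0) ^ 2)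
  have hQB := ((hB.const_mul 2).inv (by positivity)).const_mul ((x 1) ^ 2 + (x 2) ^ 2)
  have hQ : HasDerivAt (fun s => gQ (A s) (B s) x)
      ((x 0) ^ 2 * (-(2 * A') / (2 * A t) ^ 2) +
        ((x 1) ^ 2 + (x 2) ^ 2) * (-(2 * B') / (2 * B t) ^ 2)) t := by
    refine (hQA.add hQB).congr_of_eventuallyEq (Eventually.of_forall fun s => ?_)
    simp only [gQ, div_eq_mul_inv, Pi.inv_apply, Pi.add_apply]
  have hK : HasDerivAt (fun s => gK (A s) (B s) x) _ t := hC.mul hQ.neg.exp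
  refine hK.congr_deriv ?_
  simp only [gK, gC, gQ, Pi.mul_apply, Pi.neg_apply]
  -- algebra: replace `A t` by `r²/(2π)` with `r = √(2πA)`
  have hr2 : Real.sqrt (2 * π * A t) ^ 2 = 2 * π * A t := Real.sq_sqrt hpA.le
  have hr0 : 0 < Real.sqrt (2 * π * A t) := Real.sqrt_pos.2 hpA
  generalize Real.sqrt (2 * π * A t) = r at hr2 hr0 ⊢
  have hpi : (π : ℝ) ≠ 0 := Real.pi_pos.ne'
  have hAr : A t = r ^ 2 / (2 * π) := by rw [hr2]; field_simp
  have hB0 : B t ≠ 0 := hBt.ne'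
  have hr0' : r ≠ 0 := hr0.ne'
  rw [hAr]
  field_simp
  ring

/-- the adapted kernel of the linear flow: anisotropic Gaussian with variances `α(t), β(t), β(t)` [folklore] -/
def G (ν t : ℝ) (x : E3) : ℝ := gK (varA ν t) (varB ν t) x

/-- `G > 0` below `t = 1`. [folklore] -/
theorem G_pos {ν : ℝ} (hν : 0 < ν) {t : ℝ} (ht : t < 1) (x : E3) : 0 < G ν t x :=
  gK_pos (varA_pos hν ht) (varB_pos hν ht) x

/-- **Unit mass** `∫ G(t) = 1` below `t = 1`. [folklore] -/
theorem integral_G {ν : ℝ} (hν : 0 < ν) {t : ℝ} (ht : t < 1) : ∫ x, G ν t x = 1 :=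
  integral_gK (varA_pos hν ht) (varB_pos hν ht)

/-- Time derivative of `G` at fixed `x` (chain rule with the variance ODEs). [folklore] -/
theorem hasDerivAt_G {ν : ℝ} (hν : 0 < ν) {t : ℝ} (ht : t < 1) (x : E3) :
    HasDerivAt (fun s => G ν s x)
      (G ν t x * (-((2 * str t * varA ν t - 2 * ν) / (2 * varA ν t))
        - (-(str t) * varB ν t - 2 * ν) / varB ν t
        + (x 0) ^ 2 * (2 * str t * varA ν t - 2 * ν) / (2 * (varA ν t) ^ 2)
        + ((x 1) ^ 2 + (x 2) ^ 2) * (-(str t) * varB ν t - 2 * ν) / (2 * (varB ν t) ^ 2))) t :=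
  hasDerivAt_gK_comp (hasDerivAt_varA ν ht) (hasDerivAt_varB ν ht) (varA_pos hν ht) (varB_pos hν ht) x

/-- **the adjoint equation** `∂ₜG + u·∇G + νΔG = 0` for the linear flow and its kernel [folklore] -/
theorem adjoint_eq_G {ν : ℝ} (hν : 0 < ν) {t : ℝ} (ht : t ∈ Ico (0:ℝ) 1) (x : E3) :
    timeDerivWithin (Ico 0 1) (G ν) t x + fderiv ℝ (G ν t) x (vel t x) +
      ν * (Δ (G ν t)) x = 0 := by
  have hA := varA_pos hν ht.2
  have hB := varB_pos hν ht.2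
  rw [timeDerivWithin_apply,
    ((hasDerivAt_G hν ht.2 x).hasDerivWithinAt).derivWithin (uniqueDiffOn_Ico 0 1 t ht)]
  rw [show G ν t = gK (varA ν t) (varB ν t) from rfl, fderiv_gK_apply, laplacian_gK]
  simp only [vel, linVel_apply0, linVel_apply1, linVel_apply2]
  field_simp
  ring

/-! ## Part C5: joint regularity, comparability, concentration of `G` -/

/-- `G` is jointly `Cⁿ` on `(−∞, 1) × ℝ³` (every `n`). [folklore] -/
theorem contDiffOn_uncurry_G (ν : ℝ) (hν : 0 < ν) {n : ℕ∞} :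
    ContDiffOn ℝ (n : WithTop ℕ∞) (Function.uncurry (G ν)) (Iio 1 ×ˢ univ) := by
  have hmaps : MapsTo (Prod.fst : ℝ × E3 → ℝ) (Iio 1 ×ˢ univ) (Iio 1) := fun p hp =>
    (mem_prod.1 hp).1
  have hA : ContDiffOn ℝ n (fun p : ℝ × E3 => varA ν p.1) (Iio 1 ×ˢ univ) :=
    ((contDiffOn_varA ν).of_le (by exact_mod_cast le_top)).comp contDiffOn_fst hmaps
  have hB : ContDiffOn ℝ n (fun p : ℝ × E3 => varB ν p.1) (Iio 1 ×ˢ univ) :=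
    ((contDiffOn_varB ν).of_le (by exact_mod_cast le_top)).comp contDiffOn_fst hmaps
  have hApos : ∀ p ∈ Iio (1:ℝ) ×ˢ (univ : Set E3), varA ν p.1 ≠ 0 := fun p hp =>
    (varA_pos hν (mem_prod.1 hp).1).ne'
  have hBpos : ∀ p ∈ Iio (1:ℝ) ×ˢ (univ : Set E3), varB ν p.1 ≠ 0 := fun p hp =>
    (varB_pos hν (mem_prod.1 hp).1).ne'
  have hc : ∀ i : Fin 3, ContDiffOn ℝ n (fun p : ℝ × E3 => (p.2 i) ^ 2) (Iio 1 ×ˢ univ) := fun i =>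
    (((crd i).contDiff.comp contDiff_snd).pow 2).contDiffOn
  -- the normalising constant
  have hC : ContDiffOn ℝ n (fun p : ℝ × E3 => gC (varA ν p.1) (varB ν p.1)) (Iio 1 ×ˢ univ) := by
    unfold gC
    refine ContDiffOn.inv ?_ fun p hp => ?_
    · refine ((contDiffOn_const.mul hA).sqrt fun p hp => ?_).mul (contDiffOn_const.mul hB)
      have := varA_pos hν (mem_prod.1 hp).1
      positivity
    · have := varA_pos hν (mem_prod.1 hp).1
      have := varB_pos hν (mem_prod.1 hp).1
      positivity
  -- the quadratic form
  have hQ : ContDiffOn ℝ n (fun p : ℝ × E3 => gQ (varA ν p.1) (varB ν p.1) p.2) (Iio 1 ×ˢ univ) := by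
    unfold gQ
    refine ((hc 0).div (contDiffOn_const.mul hA) fun p hp => ?_).add
      (((hc 1).add (hc 2)).div (contDiffOn_const.mul hB) fun p hp => ?_)
    · exact mul_ne_zero two_ne_zero (hApos p hp)
    · exact mul_ne_zero two_ne_zero (hBpos p hp)
  exact hC.mul hQ.neg.exp

/-- `G` is jointly `C²` on `[0, 1) × ℝ³` (clause (1)). [folklore] -/
theorem contDiffOn_uncurry_G_Ico (ν : ℝ) (hν : 0 < ν) :
    ContDiffOn ℝ 2 (Function.uncurry (G ν)) (Ico 0 1 ×ˢ univ) :=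
  (contDiffOn_uncurry_G ν hν (n := 2)).mono (prod_mono Ico_subset_Iio_self Subset.rfl)

/-- `√(c τ) · (c τ) = c^{3/2} τ^{3/2}` bookkeeping: `gC (cτ) (cτ) = (2πc)^{-3/2} τ^{-3/2}` [folklore] -/
theorem gC_mul_self {c τ : ℝ} (hc : 0 < c) (hτ : 0 < τ) :
    gC (c * τ) (c * τ) = (2 * π * c) ^ (-(3:ℝ) / 2) * τ ^ (-(3:ℝ) / 2) := by
  rw [gC_self (mul_pos hc hτ), show 2 * π * (c * τ) = (2 * π * c) * τ by ring,
    Real.mul_rpow (by positivity) hτ.le]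

/-- **two-sided Gaussian comparability** of `G` on `[0, 1)` about the pole `(1, 0)` [folklore] -/
theorem G_comparable {ν : ℝ} (hν : 0 < ν) :
    ∃ c₁ c₂ C₁ C₂ : ℝ, 0 < c₁ ∧ 0 < c₂ ∧ 0 < C₁ ∧ 0 < C₂ ∧ ∀ t ∈ Ico (0:ℝ) 1, ∀ x : E3,
      c₁ * (1 - t) ^ (-(3:ℝ) / 2) * Real.exp (-(‖x - 0‖ ^ 2) / (c₂ * (1 - t))) ≤ G ν t x ∧
        G ν t x ≤ C₁ * (1 - t) ^ (-(3:ℝ) / 2) * Real.exp (-(‖x - 0‖ ^ 2) / (C₂ * (1 - t))) := by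
  set m := 2 * ν * Real.exp (-4) with hm
  set M := 2 * ν * Real.exp 4 with hM
  have hm0 : 0 < m := by positivity
  have hM0 : 0 < M := by positivity
  refine ⟨(2 * π * M) ^ (-(3:ℝ) / 2), 2 * m, (2 * π * m) ^ (-(3:ℝ) / 2), 2 * M,
    by positivity, by positivity, by positivity, by positivity, fun t ht x => ?_⟩
  have hτ : 0 < 1 - t := sub_pos.2 ht.2
  obtain ⟨hA1, hA2⟩ := varA_bounds hν.le ht.2.le
  obtain ⟨hB1, hB2⟩ := varB_bounds hν.le ht.2.le
  have e1 : Real.exp (-4) ≤ Real.exp (-2) := Real.exp_le_exp.2 (by norm_num)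
  have e2 : Real.exp 2 ≤ Real.exp 4 := Real.exp_le_exp.2 (by norm_num)
  have hmA : m * (1 - t) ≤ varA ν t := by rw [hm]; linarith
  have hmB : m * (1 - t) ≤ varB ν t := by
    rw [hm]; nlinarith [mul_le_mul_of_nonneg_right e1 (by positivity : (0:ℝ) ≤ 2 * ν * (1 - t))]
  have hAM : varA ν t ≤ M * (1 - t) := by rw [hM]; linarith
  have hBM : varB ν t ≤ M * (1 - t) := by
    rw [hM]; nlinarith [mul_le_mul_of_nonneg_right e2 (by positivity : (0:ℝ) ≤ 2 * ν * (1 - t))]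
  rw [sub_zero]
  constructor
  · have h := le_gK (mul_pos hm0 hτ) hmA hmB hAM hBM x
    rw [gC_mul_self hM0 hτ] at h
    calc (2 * π * M) ^ (-(3:ℝ) / 2) * (1 - t) ^ (-(3:ℝ) / 2) * Real.exp (-‖x‖ ^ 2 / (2 * m * (1 - t)))
        = (2 * π * M) ^ (-(3:ℝ) / 2) * (1 - t) ^ (-(3:ℝ) / 2) *
            Real.exp (-‖x‖ ^ 2 / (2 * (m * (1 - t)))) := by rw [mul_assoc 2 m]
      _ ≤ G ν t x := h
  · have h := gK_le (mul_pos hm0 hτ) hmA hmB hAM hBM x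
    rw [gC_mul_self hm0 hτ] at h
    calc G ν t x ≤ (2 * π * m) ^ (-(3:ℝ) / 2) * (1 - t) ^ (-(3:ℝ) / 2) *
            Real.exp (-‖x‖ ^ 2 / (2 * (M * (1 - t)))) := h
      _ = (2 * π * m) ^ (-(3:ℝ) / 2) * (1 - t) ^ (-(3:ℝ) / 2) *
            Real.exp (-‖x‖ ^ 2 / (2 * M * (1 - t))) := by rw [mul_assoc 2 M]

/-- the upper bound rewritten against the backward heat kernel with `4ν' = 2M` [folklore] -/
theorem G_le_heatKernel {ν : ℝ} (hν : 0 < ν) :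
    ∃ K ν' : ℝ, 0 < ν' ∧ ∀ t ∈ Ico (0:ℝ) 1, ∀ x : E3,
      G ν t x ≤ K * backwardHeatKernel ν' 1 0 t x := by
  obtain ⟨c₁, c₂, C₁, C₂, -, -, hC₁, hC₂, h⟩ := G_comparable hν
  refine ⟨C₁ * (4 * π * (C₂ / 4)) ^ ((3:ℝ) / 2), C₂ / 4, by positivity, fun t ht x => ?_⟩
  have hτ : 0 < 1 - t := sub_pos.2 ht.2
  rw [backwardHeatKernel_eq (by positivity) 0 ht.2 x]
  simp only [finrank_euclideanSpace_fin, Nat.cast_ofNat]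
  have h4 : 4 * (C₂ / 4) * (1 - t) = C₂ * (1 - t) := by ring
  rw [h4]
  have hpow : (4 * π * (C₂ / 4)) ^ ((3:ℝ) / 2) * (4 * π * (C₂ / 4)) ^ (-(3:ℝ) / 2) = 1 := by
    rw [← Real.rpow_add (by positivity)]; norm_num
  calc G ν t x ≤ C₁ * (1 - t) ^ (-(3:ℝ) / 2) * Real.exp (-(‖x - 0‖ ^ 2) / (C₂ * (1 - t))) := (h t ht x).2
    _ = C₁ * (4 * π * (C₂ / 4)) ^ ((3:ℝ) / 2) * ((4 * π * (C₂ / 4)) ^ (-(3:ℝ) / 2) *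
          (1 - t) ^ (-(3:ℝ) / 2) * Real.exp (-(‖x - 0‖ ^ 2) / (C₂ * (1 - t)))) := by
        calc C₁ * (1 - t) ^ (-(3:ℝ) / 2) * Real.exp (-(‖x - 0‖ ^ 2) / (C₂ * (1 - t)))
            = C₁ * ((4 * π * (C₂ / 4)) ^ ((3:ℝ) / 2) * (4 * π * (C₂ / 4)) ^ (-(3:ℝ) / 2)) *
              (1 - t) ^ (-(3:ℝ) / 2) * Real.exp (-(‖x - 0‖ ^ 2) / (C₂ * (1 - t))) := by
                rw [hpow, mul_one]
          _ = _ := by ring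

/-- **concentration at the pole** `(1, 0)` [folklore] -/
theorem tendsto_integral_mul_G {ν : ℝ} (hν : 0 < ν) {φ : E3 → ℝ} (hφ : Continuous φ)
    (hM : ∃ M : ℝ, ∀ x, |φ x| ≤ M) :
    Tendsto (fun t => ∫ x, φ x * G ν t x) (𝓝[<] 1) (𝓝 (φ 0)) := by
  obtain ⟨M, hM⟩ := hM
  obtain ⟨K, ν', hν', hle⟩ := G_le_heatKernel hν
  refine tendsto_integral_mul_of_le_heatKernel (K := K) hν' ?_ hφ hM
  have hIco : ∀ᶠ t in 𝓝[<] (1:ℝ), t ∈ Ico (0:ℝ) 1 := by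
    have : Ico (0:ℝ) 1 ∈ 𝓝[<] (1:ℝ) := Ico_mem_nhdsLT zero_lt_one
    exact this
  filter_upwards [hIco] with t ht
  exact ⟨fun x => (G_pos hν ht.2 x).le, integral_G hν ht.2, hle t ht⟩


end Summit.NavierStokesRegularity.NavierStokesRegularity.Theorems.AdaptedFrequencyConverges.Negative

end
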